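import Literature.GroupTheory.CombinatorialGroupTheory.FreeGroupCyclicKernelBasis
import Literature.GroupTheory.CombinatorialGroupTheory.PuncturedSurfaceGroupTwoComponentBases
import HarnessLib

/-!
# The node loop and the cusps of an unmarked-component degeneration as free-basis members OF A LEVEL

Topic `Literature/GroupTheory/CombinatorialGroupTheory`; theorems only.  `Γ = Γ_{g,r'+1} = ⟨a_i, b_i, c_j ∣
∏_i [a_i,b_i] · c_0⋯c_{r'}⟩` (`PuncturedSurfaceGroup`, [SemiAnbd] Example 2.10 [cite: MochizukiSemiAnbd2006, Ex. 2.10 p.31]),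
free on the `c_0`-eliminating basis `b₀ = (a_i, b_i, c_1, …, c_{r'})` (abc-iut-f-166,
`exists_freeGroupBasis_elim_zero`).  In the two-component degeneration with the second component UNMARKED
(handles `i ≥ g₀` and no cusp on `C₁`; abc-iut-f-164 gen 2) the node loop is `ε = w⁻¹`,
`w = ∏_{i≥g₀}[a_i,b_i]` — a product of commutators, a member of NO free basis of `Γ`.  Print ([CombGC] Prop.
1.2 proof p. 9: "possibly replacing `G` by some finite étale covering") passes to a covering; here: the
LEVEL `K = Ker(χ)`, `χ : Γ → ℤ/n` the character `a_{g₀} ↦ 1` (one handle of `C₁` unwrapped), every other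
generator `↦ 0`.  abc-iut-w5-d174's `FreeGroupBasis.exists_freeGroupBasis_cyclicKernel` gives the Schreier
basis `bK` of `K`: `Y_{x,k} = t^k x t^{-k}` (`x` a letter `≠ t = a_{g₀}`, `k ∈ ℤ/n` read in `[0,n)`) and
`T = t^n`.  In this basis (Lyndon–Schupp I.3 [cite: LyndonSchupp2001, I.3 Prop 3.8]):

* `levelBasis_conj_eq` — `t^k x t^{-k} = T^q · Y_{x, k mod n} · T^{-q}` for ALL `k : ℕ`, hence for every
  homomorphism `ψ : K → M` into a COMMUTATIVE group `ψ(t^k x t^{-k}) = ψ(Y_{x,k})` (`hom_conj_letter_eq`);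
* `hom_conj_nodeLoopInv_eq` — `ψ(t^k w t^{-k}) = ψ(Y_{b_{g₀},k+1}) · ψ(Y_{b_{g₀},k})⁻¹`
  (`w = [t, b_{g₀}] · ∏_{i>g₀}[a_i,b_i]`, commutators of elements of `K` die in `M`);
* `hom_conj_cuspZero_eq` — `ψ(t^k c_0 t^{-k}) = (ψ(t^k w t^{-k}) · ∏_{j≥1} ψ(Y_{c_j,k}))⁻¹`;
* `exists_levelBasis_nodeLoopInv` — ONE Nielsen move `Y_{b_{g₀},1} ↦ w = Y_{b_{g₀},1}·Y_{b_{g₀},0}⁻¹·∏_{i>g₀}[Y_{a_i,0},Y_{b_i,0}]`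
  makes `w` a member of a free basis of `K` (all other members unchanged);
* `exists_levelBasis_cuspZero` — likewise `c_0 = (c_1⋯c_{r'})⁻¹ w⁻¹ (∏_{i<g₀}[a_i,b_i])⁻¹` replaces `Y_{b_{g₀},1}`.

So the node group and every cusp group of the unmarked datum are closures of rank-one free factors OF THE
LEVEL `K` — the input of abc-iut-f-166's level separating engines (`ProSigmaLevelSeparating.lean`).  The
character `χ` and the basis `bK` are taken as hypotheses (`χ` is any abelian character with these values,
e.g. `exists_handleCuspCharacter`; `bK` from `exists_freeGroupBasis_cyclicKernel`).  Elementary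
combinatorial group theory; nothing here concerns [IUTchIII].
-/

namespace Literature.GroupTheory.CombinatorialGroupTheory

namespace PuncturedSurfaceGroup

open Multiplicative

section Level

variable {g r' g₀ n : ℕ} (hg : g₀ < g)
variable (b₀ : FreeGroupBasis ((Fin g × Bool) ⊕ Fin r') (PuncturedSurfaceGroup g (r' + 1)))
variable (ha : ∀ i, b₀ (Sum.inl (i, false)) = a i) (hb : ∀ i, b₀ (Sum.inl (i, true)) = b i)
variable (hc : ∀ j : Fin r', b₀ (Sum.inr j) = c (Fin.succ j))
variable (χ : PuncturedSurfaceGroup g (r' + 1) →* Multiplicative (ZMod n))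
variable (hχa : ∀ i : Fin g, χ (a i) = if (i : ℕ) = g₀ then ofAdd 1 else 1)
variable (hχb : ∀ i : Fin g, χ (b i) = 1) (hχc : ∀ j : Fin (r' + 1), χ (c j) = 1)

include ha hb hc hχa hχb hχc in
/-- The level character on the `c_0`-eliminating basis: `b₀ x ↦ 1` except `a_{g₀} ↦ 1 ∈ ℤ/n` — the shape
consumed by `FreeGroupBasis.exists_freeGroupBasis_cyclicKernel`. [cite: LyndonSchupp2001, Ch. I Prop. 3.7] -/
theorem levelCharacter_basis (x : (Fin g × Bool) ⊕ Fin r') :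
    χ (b₀ x) = if x = Sum.inl (⟨g₀, hg⟩, false) then ofAdd (1 : ZMod n) else 1 := by
  rcases x with ⟨i, _ | _⟩ | j
  · rw [ha, hχa]
    by_cases hi : (i : ℕ) = g₀
    · rw [if_pos hi, if_pos]
      rw [show i = ⟨g₀, hg⟩ from Fin.ext hi]
    · rw [if_neg hi, if_neg]
      intro h
      simp only [Sum.inl.injEq, Prod.mk.injEq, and_true] at h
      exact hi (by rw [h])
  · rw [hb, hχb, if_neg (by simp)]
  · rw [hc, hχc, if_neg (by simp)]

include hχb in
/-- A commutator `[a_i, b_i]` lies in the level (abelian target). [cite: LyndonSchupp2001, Ch. I Prop. 3.7] -/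
theorem comm_mem_levelKer (i : Fin g) : a i * b i * (a i)⁻¹ * (b i)⁻¹ ∈ χ.ker := by
  rw [MonoidHom.mem_ker, map_mul, map_mul, map_mul, map_inv, map_inv, hχb, inv_one, mul_one, mul_one,
    mul_inv_cancel]

include hχb in
/-- The padded handle products lie in the level. [cite: LyndonSchupp2001, Ch. I Prop. 3.7] -/
theorem comm_prod_ite_mem_levelKer (p : Fin g → Prop) [DecidablePred p] :
    ((List.finRange g).map fun i : Fin g => if p i then
        a (r := r' + 1) i * b i * (a i)⁻¹ * (b i)⁻¹ else 1).prod ∈ χ.ker :=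
  prod_map_finRange_ite_mem _ g p _ fun i _ => comm_mem_levelKer χ hχb i

include hχb in
/-- The handle product `w = ∏_{i≥g₀}[a_i,b_i]` of the unmarked component lies in the level.
[cite: LyndonSchupp2001, Ch. I Prop. 3.7] -/
theorem secondHandleProd_mem_levelKer :
    ((List.finRange g).map fun i : Fin g => if g₀ ≤ (i : ℕ) then
        a (r := r' + 1) i * b i * (a i)⁻¹ * (b i)⁻¹ else 1).prod ∈ χ.ker :=
  comm_prod_ite_mem_levelKer χ hχb _

include hχc in
/-- Every cusp lies in the level. [cite: LyndonSchupp2001, Ch. I Prop. 3.7] -/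
theorem c_mem_levelKer (j : Fin (r' + 1)) : c (g := g) j ∈ χ.ker := by
  rw [MonoidHom.mem_ker, hχc]

/-- Conjugates by powers of `t` of level elements lie in the level (normality).
[cite: LyndonSchupp2001, Ch. I Prop. 3.7] -/
theorem conj_pow_mem_levelKer {x : PuncturedSurfaceGroup g (r' + 1)} (hx : x ∈ χ.ker)
    (t : PuncturedSurfaceGroup g (r' + 1)) (k : ℕ) : t ^ k * x * (t ^ k)⁻¹ ∈ χ.ker := by
  rw [MonoidHom.mem_ker] at hx ⊢
  rw [map_mul, map_mul, map_inv, hx, mul_one, mul_inv_cancel]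

/-! ### Conjugates of letters by arbitrary powers of `t` -/

include ha in
/-- **`t^k x t^{-k} = T^q · Y_{x, k mod n} · T^{-q}`** in the level, `k = qn + (k mod n)`, `T = t^n`, for the
Schreier basis `bK` of abc-iut-w5-d174 (`Y_{x,a} = t^{a} x t^{-a}`, `T = t^n`).
[cite: LyndonSchupp2001, Ch. I Prop. 3.7] -/
theorem levelBasis_conj_eq
    (bK : FreeGroupBasis (({x : (Fin g × Bool) ⊕ Fin r' // x ≠ Sum.inl (⟨g₀, hg⟩, false)} × ZMod n) ⊕ Unit)
      χ.ker)
    (hbK : ∀ (x : {x : (Fin g × Bool) ⊕ Fin r' // x ≠ Sum.inl (⟨g₀, hg⟩, false)}) (k : ZMod n),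
      ((bK (Sum.inl (x, k)) : χ.ker) : PuncturedSurfaceGroup g (r' + 1)) =
        b₀ (Sum.inl (⟨g₀, hg⟩, false)) ^ k.val * b₀ x.1 * (b₀ (Sum.inl (⟨g₀, hg⟩, false)) ^ k.val)⁻¹)
    (hbKT : ((bK (Sum.inr ()) : χ.ker) : PuncturedSurfaceGroup g (r' + 1)) =
      b₀ (Sum.inl (⟨g₀, hg⟩, false)) ^ n)
    (x : (Fin g × Bool) ⊕ Fin r') (hxt : x ≠ Sum.inl (⟨g₀, hg⟩, false)) (k : ℕ)
    (hx : a ⟨g₀, hg⟩ ^ k * b₀ x * (a ⟨g₀, hg⟩ ^ k)⁻¹ ∈ χ.ker) :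
    (⟨a ⟨g₀, hg⟩ ^ k * b₀ x * (a ⟨g₀, hg⟩ ^ k)⁻¹, hx⟩ : χ.ker) =
      bK (Sum.inr ()) ^ (k / n) * bK (Sum.inl (⟨x, hxt⟩, (k : ZMod n))) * (bK (Sum.inr ()) ^ (k / n))⁻¹ := by
  apply Subtype.ext
  show a ⟨g₀, hg⟩ ^ k * b₀ x * (a ⟨g₀, hg⟩ ^ k)⁻¹ = _
  simp only [Subgroup.coe_mul, Subgroup.coe_inv, SubmonoidClass.coe_pow, hbK, hbKT, ZMod.val_natCast, ha]
  rw [← pow_mul]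
  conv_lhs => rw [← Nat.div_add_mod k n, pow_add]
  group

include ha in
/-- **Homomorphisms into commutative groups do not see the `T`-conjugation**:
`ψ(t^k x t^{-k}) = ψ(Y_{x,k})` for all `k : ℕ`. [cite: LyndonSchupp2001, Ch. I Prop. 3.7] -/
theorem hom_conj_letter_eq
    (bK : FreeGroupBasis (({x : (Fin g × Bool) ⊕ Fin r' // x ≠ Sum.inl (⟨g₀, hg⟩, false)} × ZMod n) ⊕ Unit)
      χ.ker)
    (hbK : ∀ (x : {x : (Fin g × Bool) ⊕ Fin r' // x ≠ Sum.inl (⟨g₀, hg⟩, false)}) (k : ZMod n),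
      ((bK (Sum.inl (x, k)) : χ.ker) : PuncturedSurfaceGroup g (r' + 1)) =
        b₀ (Sum.inl (⟨g₀, hg⟩, false)) ^ k.val * b₀ x.1 * (b₀ (Sum.inl (⟨g₀, hg⟩, false)) ^ k.val)⁻¹)
    (hbKT : ((bK (Sum.inr ()) : χ.ker) : PuncturedSurfaceGroup g (r' + 1)) =
      b₀ (Sum.inl (⟨g₀, hg⟩, false)) ^ n)
    {M : Type*} [CommGroup M] (ψ : χ.ker →* M)
    (x : (Fin g × Bool) ⊕ Fin r') (hxt : x ≠ Sum.inl (⟨g₀, hg⟩, false)) (k : ℕ)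
    (hx : a ⟨g₀, hg⟩ ^ k * b₀ x * (a ⟨g₀, hg⟩ ^ k)⁻¹ ∈ χ.ker) :
    ψ ⟨a ⟨g₀, hg⟩ ^ k * b₀ x * (a ⟨g₀, hg⟩ ^ k)⁻¹, hx⟩ = ψ (bK (Sum.inl (⟨x, hxt⟩, (k : ZMod n)))) := by
  rw [levelBasis_conj_eq hg b₀ ha χ bK hbK hbKT x hxt k hx, map_mul, map_mul, map_inv, mul_inv_cancel_comm]

/-! ### The node loop `w = [t, b_{g₀}] · ∏_{i>g₀}[a_i,b_i]` through the level basis -/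

/-- `w = [a_{g₀}, b_{g₀}] · ∏_{i > g₀}[a_i,b_i]` (peeling the first factor).
[cite: MochizukiSemiAnbd2006, Ex. 2.10 p.31] -/
theorem secondHandleProd_eq_comm_mul :
    ((List.finRange g).map fun i : Fin g => if g₀ ≤ (i : ℕ) then
        a (r := r' + 1) i * b i * (a i)⁻¹ * (b i)⁻¹ else 1).prod =
      a ⟨g₀, hg⟩ * b ⟨g₀, hg⟩ * (a ⟨g₀, hg⟩)⁻¹ * (b ⟨g₀, hg⟩)⁻¹ *
        ((List.finRange g).map fun i : Fin g => if g₀ + 1 ≤ (i : ℕ) then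
          a (r := r' + 1) i * b i * (a i)⁻¹ * (b i)⁻¹ else 1).prod :=
  prod_map_finRange_ite_le_peel g g₀ hg _

/-- Conjugation by `s` of a list product is the product of the conjugates (an inner automorphism is a
homomorphism). [cite: LyndonSchupp2001, Ch. I Prop. 3.7] -/
theorem conj_list_prod_eq {G : Type*} [Group G] (s : G) (L : List G) :
    s * L.prod * s⁻¹ = (L.map fun y => s * y * s⁻¹).prod := by
  induction L with
  | nil => simp
  | cons y L ih =>
    rw [List.map_cons, List.prod_cons, List.prod_cons, ← ih]
    group

include hχa hχb in
/-- **A homomorphism of the level into a COMMUTATIVE group kills the conjugates of the handle products**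
`s (∏_{p i}[a_i,b_i]) s⁻¹` whose handles lie in the level (`i ≠ g₀`): each factor is a commutator of two
elements of `K`. [cite: LyndonSchupp2001, Ch. I Prop. 3.7] -/
theorem hom_conj_comm_prod_eq_one {M : Type*} [CommGroup M] (ψ : χ.ker →* M) (p : Fin g → Prop)
    [DecidablePred p] (hp : ∀ i, p i → (i : ℕ) ≠ g₀) (s : PuncturedSurfaceGroup g (r' + 1))
    (hx : s * ((List.finRange g).map fun i : Fin g => if p i then
        a (r := r' + 1) i * b i * (a i)⁻¹ * (b i)⁻¹ else 1).prod * s⁻¹ ∈ χ.ker) :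
    ψ ⟨s * ((List.finRange g).map fun i : Fin g => if p i then
        a (r := r' + 1) i * b i * (a i)⁻¹ * (b i)⁻¹ else 1).prod * s⁻¹, hx⟩ = 1 := by
  classical
  -- the conjugated letters, as elements of `K`
  have haK : ∀ i, p i → s * a (r := r' + 1) i * s⁻¹ ∈ χ.ker := fun i hi => by
    rw [MonoidHom.mem_ker, map_mul, map_mul, map_inv, hχa, if_neg (hp i hi), mul_one, mul_inv_cancel]
  have hbK' : ∀ i, s * b (r := r' + 1) i * s⁻¹ ∈ χ.ker := fun i => by
    rw [MonoidHom.mem_ker, map_mul, map_mul, map_inv, hχb, mul_one, mul_inv_cancel]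
  let F : Fin g → χ.ker := fun i => if hi : p i then
    ⟨s * a i * s⁻¹, haK i hi⟩ * ⟨s * b i * s⁻¹, hbK' i⟩ * ⟨s * a i * s⁻¹, haK i hi⟩⁻¹ * ⟨s * b i * s⁻¹, hbK' i⟩⁻¹
    else 1
  have hF : ∀ i, ψ (F i) = 1 := fun i => by
    by_cases hi : p i
    · simp only [F, dif_pos hi, map_mul, map_inv, mul_inv_cancel_comm, mul_inv_cancel]
    · simp only [F, dif_neg hi, map_one]
  have hprod : (⟨s * ((List.finRange g).map fun i : Fin g => if p i then
      a (r := r' + 1) i * b i * (a i)⁻¹ * (b i)⁻¹ else 1).prod * s⁻¹, hx⟩ : χ.ker) =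
      ((List.finRange g).map F).prod := by
    apply Subtype.ext
    show s * _ * s⁻¹ = _
    rw [SubmonoidClass.coe_list_prod, List.map_map, conj_list_prod_eq, List.map_map]
    refine congrArg List.prod (List.map_congr_left fun i _ => ?_)
    by_cases hi : p i
    · simp only [Function.comp_apply, if_pos hi, F, dif_pos hi, Subgroup.coe_mul, Subgroup.coe_inv]
      group
    · simp only [Function.comp_apply, if_neg hi, F, dif_neg hi, Subgroup.coe_one]
      group
  rw [hprod, map_list_prod, List.map_map]
  exact List.prod_eq_one fun y hy => by
    obtain ⟨i, -, rfl⟩ := List.mem_map.mp hy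
    exact hF i

include ha hb hχa hχb in
/-- **The node loop through the level basis (abelian readings)**: for `ψ : K → M` with `M` commutative and
every `k : ℕ`, `ψ(t^k w t^{-k}) = ψ(Y_{b_{g₀}, k+1}) · ψ(Y_{b_{g₀}, k})⁻¹`, `w = ∏_{i≥g₀}[a_i,b_i]`, `t = a_{g₀}`.
[cite: LyndonSchupp2001, Ch. I Prop. 3.7] -/
theorem hom_conj_secondHandleProd_eq
    (bK : FreeGroupBasis (({x : (Fin g × Bool) ⊕ Fin r' // x ≠ Sum.inl (⟨g₀, hg⟩, false)} × ZMod n) ⊕ Unit)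
      χ.ker)
    (hbK : ∀ (x : {x : (Fin g × Bool) ⊕ Fin r' // x ≠ Sum.inl (⟨g₀, hg⟩, false)}) (k : ZMod n),
      ((bK (Sum.inl (x, k)) : χ.ker) : PuncturedSurfaceGroup g (r' + 1)) =
        b₀ (Sum.inl (⟨g₀, hg⟩, false)) ^ k.val * b₀ x.1 * (b₀ (Sum.inl (⟨g₀, hg⟩, false)) ^ k.val)⁻¹)
    (hbKT : ((bK (Sum.inr ()) : χ.ker) : PuncturedSurfaceGroup g (r' + 1)) =
      b₀ (Sum.inl (⟨g₀, hg⟩, false)) ^ n)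
    {M : Type*} [CommGroup M] (ψ : χ.ker →* M) (k : ℕ)
    (hx : a ⟨g₀, hg⟩ ^ k * ((List.finRange g).map fun i : Fin g => if g₀ ≤ (i : ℕ) then
        a (r := r' + 1) i * b i * (a i)⁻¹ * (b i)⁻¹ else 1).prod * (a ⟨g₀, hg⟩ ^ k)⁻¹ ∈ χ.ker) :
    ψ ⟨a ⟨g₀, hg⟩ ^ k * ((List.finRange g).map fun i : Fin g => if g₀ ≤ (i : ℕ) then
        a (r := r' + 1) i * b i * (a i)⁻¹ * (b i)⁻¹ else 1).prod * (a ⟨g₀, hg⟩ ^ k)⁻¹, hx⟩ =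
      ψ (bK (Sum.inl (⟨Sum.inl (⟨g₀, hg⟩, true), by simp⟩, ((k + 1 : ℕ) : ZMod n)))) *
        (ψ (bK (Sum.inl (⟨Sum.inl (⟨g₀, hg⟩, true), by simp⟩, (k : ZMod n)))))⁻¹ := by
  -- the three factors `t^{k+1} B t^{-(k+1)}`, `(t^k B t^{-k})⁻¹`, `t^k u t^{-k}` as elements of `K`
  have hB1 : a ⟨g₀, hg⟩ ^ (k + 1) * b₀ (Sum.inl (⟨g₀, hg⟩, true)) * (a ⟨g₀, hg⟩ ^ (k + 1))⁻¹ ∈ χ.ker :=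
    conj_pow_mem_levelKer χ (by rw [MonoidHom.mem_ker, hb, hχb]) _ (k + 1)
  have hB0 : a ⟨g₀, hg⟩ ^ k * b₀ (Sum.inl (⟨g₀, hg⟩, true)) * (a ⟨g₀, hg⟩ ^ k)⁻¹ ∈ χ.ker :=
    conj_pow_mem_levelKer χ (by rw [MonoidHom.mem_ker, hb, hχb]) _ k
  have hu : a ⟨g₀, hg⟩ ^ k * ((List.finRange g).map fun i : Fin g => if g₀ + 1 ≤ (i : ℕ) then
      a (r := r' + 1) i * b i * (a i)⁻¹ * (b i)⁻¹ else 1).prod * (a ⟨g₀, hg⟩ ^ k)⁻¹ ∈ χ.ker :=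
    conj_pow_mem_levelKer χ (comm_prod_ite_mem_levelKer χ hχb _) _ k
  have hsplit : (⟨a ⟨g₀, hg⟩ ^ k * ((List.finRange g).map fun i : Fin g => if g₀ ≤ (i : ℕ) then
      a (r := r' + 1) i * b i * (a i)⁻¹ * (b i)⁻¹ else 1).prod * (a ⟨g₀, hg⟩ ^ k)⁻¹, hx⟩ : χ.ker) =
      ⟨_, hB1⟩ * ⟨_, hB0⟩⁻¹ * ⟨_, hu⟩ := by
    apply Subtype.ext
    show a ⟨g₀, hg⟩ ^ k * _ * (a ⟨g₀, hg⟩ ^ k)⁻¹ = _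
    simp only [Subgroup.coe_mul, Subgroup.coe_inv]
    rw [secondHandleProd_eq_comm_mul hg, pow_succ, hb]
    group
  rw [hsplit, map_mul, map_mul, map_inv, hom_conj_comm_prod_eq_one χ hχa hχb ψ _ (fun i hi => by omega)
    _ hu, mul_one, hom_conj_letter_eq hg b₀ ha χ bK hbK hbKT ψ _ (by simp) (k + 1) hB1,
    hom_conj_letter_eq hg b₀ ha χ bK hbK hbKT ψ _ (by simp) k hB0]

/-! ### The cusp `c_0 = w⁻¹ · (∏_{i<g₀}[a_i,b_i])⁻¹ · (c_1⋯c_{r'})⁻¹` through the level basis -/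

/-- **`c_0` in terms of the two handle blocks and the other cusps**:
`c_0 = (∏_{i≥g₀}[a_i,b_i])⁻¹ · (∏_{i<g₀}[a_i,b_i])⁻¹ · (c_1⋯c_{r'})⁻¹` (the surface relation).
[cite: MochizukiSemiAnbd2006, Ex. 2.10 p.31] -/
theorem c_zero_eq_inv_mul (g₀ : ℕ) :
    (c (g := g) (0 : Fin (r' + 1))) =
      (((List.finRange g).map fun i : Fin g => if g₀ ≤ (i : ℕ) then
          a (r := r' + 1) i * b i * (a i)⁻¹ * (b i)⁻¹ else 1).prod)⁻¹ *
        (((List.finRange g).map fun i : Fin g => if (i : ℕ) < g₀ then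
          a (r := r' + 1) i * b i * (a i)⁻¹ * (b i)⁻¹ else 1).prod)⁻¹ *
        (((List.finRange (r' + 1)).map fun j : Fin (r' + 1) => if 1 ≤ (j : ℕ) then c (g := g) j else 1).prod)⁻¹ := by
  have h := comm_prod_mul_cusp_prod_eq_one (g := g) (r := r' + 1)
  have hC : ((List.finRange (r' + 1)).map fun j : Fin (r' + 1) => c (g := g) j).prod =
      c 0 * ((List.finRange (r' + 1)).map fun j : Fin (r' + 1) => if 1 ≤ (j : ℕ) then c (g := g) j else 1).prod := by
    have e : (fun j : Fin (r' + 1) => c (g := g) j) =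
        fun j : Fin (r' + 1) => if 0 ≤ (j : ℕ) then c (g := g) j else 1 := by
      funext j; rw [if_pos (Nat.zero_le _)]
    rw [e, prod_map_finRange_ite_le_peel (r' + 1) 0 (Nat.succ_pos r')]
    rfl
  rw [hC, prod_map_finRange_split g g₀] at h
  set v := ((List.finRange g).map fun i : Fin g => if (i : ℕ) < g₀ then
      a (r := r' + 1) i * b i * (a i)⁻¹ * (b i)⁻¹ else 1).prod
  set w := ((List.finRange g).map fun i : Fin g => if g₀ ≤ (i : ℕ) then
      a (r := r' + 1) i * b i * (a i)⁻¹ * (b i)⁻¹ else 1).prod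
  set C := ((List.finRange (r' + 1)).map fun j : Fin (r' + 1) => if 1 ≤ (j : ℕ) then c (g := g) j else 1).prod
  -- `v w (c_0 C) = 1`
  have h' : c (g := g) 0 = (v * w)⁻¹ * C⁻¹ := by
    rw [← mul_assoc] at h
    have h1 : v * w * c 0 = C⁻¹ := eq_inv_of_mul_eq_one_left h
    rw [← h1]; group
  rw [h', mul_inv_rev]

include ha hb hc hχa hχb hχc in
/-- **The cusp `c_0` through the level basis (abelian readings)**: for `ψ : K → M`, `M` commutative,
`ψ(t^k c_0 t^{-k}) = (ψ(Y_{b_{g₀},k+1}) · ψ(Y_{b_{g₀},k})⁻¹ · ∏_{j<r'} ψ(Y_{c_{j+1},k}))⁻¹`.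
[cite: LyndonSchupp2001, Ch. I Prop. 3.7] -/
theorem hom_conj_cuspZero_eq
    (bK : FreeGroupBasis (({x : (Fin g × Bool) ⊕ Fin r' // x ≠ Sum.inl (⟨g₀, hg⟩, false)} × ZMod n) ⊕ Unit)
      χ.ker)
    (hbK : ∀ (x : {x : (Fin g × Bool) ⊕ Fin r' // x ≠ Sum.inl (⟨g₀, hg⟩, false)}) (k : ZMod n),
      ((bK (Sum.inl (x, k)) : χ.ker) : PuncturedSurfaceGroup g (r' + 1)) =
        b₀ (Sum.inl (⟨g₀, hg⟩, false)) ^ k.val * b₀ x.1 * (b₀ (Sum.inl (⟨g₀, hg⟩, false)) ^ k.val)⁻¹)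
    (hbKT : ((bK (Sum.inr ()) : χ.ker) : PuncturedSurfaceGroup g (r' + 1)) =
      b₀ (Sum.inl (⟨g₀, hg⟩, false)) ^ n)
    {M : Type*} [CommGroup M] (ψ : χ.ker →* M) (k : ℕ)
    (hx : a ⟨g₀, hg⟩ ^ k * c 0 * (a ⟨g₀, hg⟩ ^ k)⁻¹ ∈ χ.ker) :
    ψ ⟨a ⟨g₀, hg⟩ ^ k * c 0 * (a ⟨g₀, hg⟩ ^ k)⁻¹, hx⟩ =
      (ψ (bK (Sum.inl (⟨Sum.inl (⟨g₀, hg⟩, true), by simp⟩, ((k + 1 : ℕ) : ZMod n)))) *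
        (ψ (bK (Sum.inl (⟨Sum.inl (⟨g₀, hg⟩, true), by simp⟩, (k : ZMod n)))))⁻¹ *
        ((List.finRange r').map fun j : Fin r' =>
          ψ (bK (Sum.inl (⟨Sum.inr j, by simp⟩, (k : ZMod n))))).prod)⁻¹ := by
  classical
  have hw : a ⟨g₀, hg⟩ ^ k * ((List.finRange g).map fun i : Fin g => if g₀ ≤ (i : ℕ) then
      a (r := r' + 1) i * b i * (a i)⁻¹ * (b i)⁻¹ else 1).prod * (a ⟨g₀, hg⟩ ^ k)⁻¹ ∈ χ.ker :=
    conj_pow_mem_levelKer χ (comm_prod_ite_mem_levelKer χ hχb _) _ k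
  have hv : a ⟨g₀, hg⟩ ^ k * ((List.finRange g).map fun i : Fin g => if (i : ℕ) < g₀ then
      a (r := r' + 1) i * b i * (a i)⁻¹ * (b i)⁻¹ else 1).prod * (a ⟨g₀, hg⟩ ^ k)⁻¹ ∈ χ.ker :=
    conj_pow_mem_levelKer χ (comm_prod_ite_mem_levelKer χ hχb _) _ k
  have hCmem : ((List.finRange (r' + 1)).map fun j : Fin (r' + 1) =>
      if 1 ≤ (j : ℕ) then c (g := g) j else 1).prod ∈ χ.ker :=
    prod_map_finRange_ite_mem _ _ _ _ fun j _ => c_mem_levelKer χ hχc j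
  have hC : a ⟨g₀, hg⟩ ^ k * ((List.finRange (r' + 1)).map fun j : Fin (r' + 1) =>
      if 1 ≤ (j : ℕ) then c (g := g) j else 1).prod * (a ⟨g₀, hg⟩ ^ k)⁻¹ ∈ χ.ker :=
    conj_pow_mem_levelKer χ hCmem _ k
  -- split `t^k c_0 t^{-k}` in `K`
  have hsplit : (⟨a ⟨g₀, hg⟩ ^ k * c 0 * (a ⟨g₀, hg⟩ ^ k)⁻¹, hx⟩ : χ.ker) =
      (⟨_, hC⟩ * ⟨_, hv⟩ * ⟨_, hw⟩)⁻¹ := by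
    apply Subtype.ext
    show a ⟨g₀, hg⟩ ^ k * c 0 * (a ⟨g₀, hg⟩ ^ k)⁻¹ = _
    simp only [Subgroup.coe_mul, Subgroup.coe_inv]
    rw [c_zero_eq_inv_mul g₀]
    group
  -- the cusp block: each `t^k c_{j+1} t^{-k}` is the basis member `Y_{c_{j+1}, k}`
  have hcj : ∀ j : Fin r', a ⟨g₀, hg⟩ ^ k * b₀ (Sum.inr j) * (a ⟨g₀, hg⟩ ^ k)⁻¹ ∈ χ.ker := fun j =>
    conj_pow_mem_levelKer χ (by rw [hc]; exact c_mem_levelKer χ hχc _) _ k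
  have hCprod : (⟨_, hC⟩ : χ.ker) = ((List.finRange r').map fun j : Fin r' =>
      (⟨a ⟨g₀, hg⟩ ^ k * b₀ (Sum.inr j) * (a ⟨g₀, hg⟩ ^ k)⁻¹, hcj j⟩ : χ.ker)).prod := by
    apply Subtype.ext
    show a ⟨g₀, hg⟩ ^ k * _ * (a ⟨g₀, hg⟩ ^ k)⁻¹ = _
    rw [SubmonoidClass.coe_list_prod, List.map_map, conj_list_prod_eq, List.map_map]
    -- re-index the padded product over `Fin (r'+1)` as a product over `Fin r'`
    have e : ((List.finRange (r' + 1)).map ((fun y => a ⟨g₀, hg⟩ ^ k * y * (a ⟨g₀, hg⟩ ^ k)⁻¹) ∘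
        fun j : Fin (r' + 1) => if 1 ≤ (j : ℕ) then c (g := g) j else 1)).prod =
        ((List.finRange r').map fun j : Fin r' =>
          a ⟨g₀, hg⟩ ^ k * c (g := g) (Fin.succ j) * (a ⟨g₀, hg⟩ ^ k)⁻¹).prod := by
      rw [List.finRange_succ, List.map_cons, List.prod_cons, List.map_map]
      have h0 : ((fun y => a ⟨g₀, hg⟩ ^ k * y * (a ⟨g₀, hg⟩ ^ k)⁻¹) ∘
          fun j : Fin (r' + 1) => if 1 ≤ (j : ℕ) then c (g := g) j else 1) 0 = 1 := by
        simp
      rw [h0, one_mul]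
      refine congrArg List.prod (List.map_congr_left fun j _ => ?_)
      simp only [Function.comp_apply, Fin.val_succ, le_add_iff_nonneg_left, zero_le, if_true]
    rw [e]
    refine congrArg List.prod (List.map_congr_left fun j _ => ?_)
    simp only [Function.comp_apply, hc]
  rw [hsplit, map_inv, map_mul, map_mul, hom_conj_secondHandleProd_eq hg b₀ ha hb χ hχa hχb bK hbK hbKT ψ k hw,
    hom_conj_comm_prod_eq_one χ hχa hχb ψ _ (fun i hi => by omega) _ hv, mul_one, hCprod, map_list_prod,
    List.map_map, mul_comm]
  congr 2
  refine congrArg List.prod (List.map_congr_left fun j _ => ?_)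
  simp only [Function.comp_apply]
  exact hom_conj_letter_eq hg b₀ ha χ bK hbK hbKT ψ _ (by simp) k (hcj j)

end Level

end PuncturedSurfaceGroup

end Literature.GroupTheory.CombinatorialGroupTheory
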